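import Summits.BirchSwinnertonDyer.BirchSwinnertonDyer.Theorems.PrintX9StabilizedClassOfKolyvaginSystemLeaf
import Summits.BirchSwinnertonDyer.BirchSwinnertonDyer.Theorems.PrintX9HowardContainmentOfPrintStubRescaling
import Literature.NumberTheory.EllipticCurves.HeegnerStabilizedClassOfCoherentPairProofs
import Literature.NumberTheory.EllipticCurves.HeegnerGeomCoherentDataOfFrameProofs
import Literature.NumberTheory.EllipticCurves.HeegnerCharIdealEnvelopePowTransferProofs
import Literature.NumberTheory.EllipticCurves.AnticyclotomicTowerSharpProofs
import Literature.NumberTheory.EllipticCurves.CastellaGrossiSkinner2025.HeegnerKolyvaginBoundAnyClassNumberProofs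
import HarnessLib

/-!
# The UNTIED Howard containment `∃ F, I(ℋ_∞(F))² ⊆ char_Λ(X_tors)` from the KOLYVAGIN-SYSTEM leaf (CGLS 2022 Thm. 4.1.1 in
# its `𝐊𝐒` form, F-411) and CGS 2025 Thm. 6.5.2 — class-free, route-free; the twin of `UntiedHowardContainmentOfPrint`
# (p685238) with the leaf `CGLSHeegnerClassNonvanishing` (27103, `∀ C` torsion form) REPLACED by `CGLSHeegnerKolyvaginSystem` (23236)

Cell `pub/bsd-print-x9`, seat `bsd-line-x10b-p2` (LEAD g11), write-crux stmt-BirchSwinnertonDyer-23729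
`PrintX10b.HowardContainmentAnyClassNumberX10b`. Same scaling reduction as the sibling core `PrintX10bUntiedHowardContainmentOfPrintCore`
(`howardContainment_untied_of_thm411_of_thm652`), with ONE input swapped following the x9-p1 LEAD's finding «hNV-ELIMINABLE»
(2026-08-29, `PrintX9StabilizedClassOfKolyvaginSystemLeaf`): the torsion of `𝔖/Λκ_∞(C)` at the engine's coherent datum is taken
not from the `∀ C` leaf `thm411_torsionFree_heegnerClass_ne_bot_quotient_isTorsion` (27103) but from the Kolyvagin-system leaf
`thm411_exists_kolyvaginSystem_one_ne_zero` (23236, already a `closes` binder of both print routes) through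
`HeegnerStabilizedOfKSLeaf.torsionFree_and_isTorsion_quotient_of_kolyvaginSystemLeaf` (F-411 ⟹ `κ_∞ ≠ 0`; with `Λ`-rank one of `𝔖`
from Thm. 6.5.2 and the kernel's torsion-freeness, `𝔖/Λκ_∞(C)` is torsion), run at the engine's coherent pair WITH CLASS
(`exists_coherent_pair_envelope_class`: `Λκ_∞(C) = Λ ∙ κ_∞`).

* `howardContainment_untied_localized_of_kolyvaginSystemLeaf_of_thm652` — the PINNED `p`-localized package for a given `jbar`,
  `Dt`, `H`: `∃ D F X m, F.Dt = Dt ∧ F.β = H.β ∧ 𝔖 f.g. ∧ finrank 𝔖 = 1 ∧ 𝔖/ℋ_∞(F) torsion ∧ (p^m)·I(ℋ_∞(F))² ⊆ char`.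
* `howardContainment_untied_of_kolyvaginSystemLeaf_of_thm652` — the untied integral containment `∃ D F X, I(ℋ_∞(F))² ⊆ char` by
  the μ-blind promotion `PrintX9Rescaling.howardContainment_of_localized_family` (`F := p^m • F₀`, fed by (h1) along the tower).

Hypotheses: `Thm413Hypotheses (W.conductorNorm ℤ) W K p κ γ`, `p` split in `K`, `p ∤ N_E` — ANY class number, torsion depth,
Selmer corank, odd `p`. HONEST FRAMING: CONDITIONAL on the two cite-only leaves (statement-only Literature facts); NOT route
currency (PIN-1 / R0: the untied `∃ F` is μ-blind); «beyond-print theorem»: no. No summit statement is proved; BSD is NOT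
proved by any of this.

References: [CastellaGrossiLeeSkinner2022] Thm. 4.1.1 (Kolyvagin system κ^{Hg}, κ₁ ≠ 0), Rem. 4.1.4, §3.2/§4.1;
[CastellaGrossiSkinner2025] Thm. 6.5.2; [Howard2004HeegnerKolyvagin] §1, §3.3, Thm. 2.2.10; [PerrinRiou1987BSMF] §1 p. 405, §3.4;
[Cornut2002] (the source of κ₁ ≠ 0).
-/

set_option linter.dupNamespace false
set_option autoImplicit false

noncomputable section

open scoped Classical Pointwise
open WeierstrassCurve Literature.NumberTheory.EllipticCurves
  Literature.NumberTheory.EllipticCurves.ModularForms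
  Literature.NumberTheory.EllipticCurves.CastellaGrossiLeeSkinner2022
open Summit.BirchSwinnertonDyer.BirchSwinnertonDyer.Theorems

namespace Summit.BirchSwinnertonDyer.BirchSwinnertonDyer.Theorems.UntiedHowardContainmentOfKSLeaf

/-- Ideal bookkeeping: `(a) · ((b) · I)² = (a·b²) · I²`. [folklore] -/
private theorem span_singleton_mul_sq {R : Type*} [CommSemiring R] (a b : R) (I : Ideal R) :
    Ideal.span {a} * (Ideal.span {b} * I) ^ 2 = Ideal.span {a * b ^ 2} * I ^ 2 := by
  rw [mul_pow, Ideal.span_singleton_pow, ← mul_assoc, Ideal.span_singleton_mul_span_singleton]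

/-- **The PINNED `p`-localized Howard containment from the Kolyvagin-system leaf (CGLS 2022 Thm. 4.1.1, `𝐊𝐒` form) and CGS 2025
Thm. 6.5.2**, class-free and route-free: on a frame satisfying `Thm413Hypotheses (W.conductorNorm ℤ) W K p κ γ` with `p` split in
`K` and `p ∤ N_E`, for every `jbar`, `Dt`, `H` there are `D`, a Heegner family `F` ON `(Dt, H.β)`, `X` and `m : ℕ` with `𝔖` finitely
generated of `Λ`-rank one, `𝔖/ℋ_∞(F)` torsion and `(p^m) · I(ℋ_∞(F))² ⊆ char_Λ(X_{Λ-tors})`. The coherent pair WITH CLASS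
(`exists_coherent_pair_envelope_class`), `Λ`-rank one and `(p^{m'})·I(Λκ_∞(C))² ⊆ char` from Thm. 6.5.2, torsion of `𝔖/Λκ_∞(C)`
from F-411 at the class `κ_∞` (`HeegnerStabilizedOfKSLeaf.torsionFree_and_isTorsion_quotient_of_kolyvaginSystemLeaf`), then the
reverse / forward envelopes. [cite: CastellaGrossiLeeSkinner2022, Thm. 4.1.1 and Rem. 4.1.4 (arXiv:2008.02571v2 TeX L2203–2294)]
[cite: CastellaGrossiSkinner2025, Thm. 6.5.2 (final TeX l.3229–3238)] [cite: PerrinRiou1987BSMF, §3.4 Prop. 10] -/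
theorem howardContainment_untied_localized_of_kolyvaginSystemLeaf_of_thm652
    (hKS : thm411_exists_kolyvaginSystem_one_ne_zero)
    (h652 : CastellaGrossiSkinner2025.thm652_stabilized_rankOne_charIdeal_torsion_dvd_pLocalized.{0})
    {W : WeierstrassCurve ℚ} [W.IsGloballyMinimal] [NeZero (W.conductorNorm ℤ)] {p : ℕ} [Fact p.Prime]
    {K : Type} [Field K] [NumberField K] {κ : ZpExtension K p} {γ : Field.absoluteGaloisGroup K}
    (hyp : Thm413Hypotheses (W.conductorNorm ℤ) W K p κ γ) (hHp : SatisfiesHeegnerHypothesis p K)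
    (hpN : ¬ p ∣ W.conductorNorm ℤ) (jbar : AlgebraicClosure K →+* ℂ)
    (Dt : ModularParametrizationData W (W.conductorNorm ℤ)) (H : HeegnerDatum (W.conductorNorm ℤ) (NumberField.discr K)) :
    ∃ (D : (W.baseChange K).LambdaAdicSelmerData κ γ) (F : HeegnerFamily (W.conductorNorm ℤ) W K κ jbar)
      (X : (W.baseChange K).SelmerDualData κ γ) (m : ℕ),
      F.Dt = Dt ∧ F.β = H.β ∧
      Module.Finite (IwasawaAlgebra p) D.S ∧ Module.finrank (IwasawaAlgebra p) D.S = 1 ∧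
      Module.IsTorsion (IwasawaAlgebra p) (D.S ⧸ heegnerModule D F) ∧
      Ideal.span {((p : IwasawaAlgebra p) ^ m)} * heegnerCharIdeal D F ^ 2 ≤
        Module.charIdeal (IwasawaAlgebra p) (Submodule.torsion (IwasawaAlgebra p) X.X) := by
  haveI : W.IsElliptic := hyp.isElliptic
  have hp : p.Prime := Fact.out
  have hp_odd : Odd p := hp.odd_of_ne_two hyp.p_ne_two
  have hK : IsImaginaryQuadratic K := hyp.isImaginaryQuadratic
  -- the data `𝔖`, `X`
  obtain ⟨D⟩ := LambdaAdicSelmerDataExists.nonempty_lambdaAdicSelmerData (W.baseChange K) p κ hyp.topGenerator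
  obtain ⟨X⟩ := (W.baseChange K).nonempty_selmerDualData_holds κ γ hyp.topGenerator
  -- the coherent pair on `(Dt, H.β)` WITH its class `z = κ_∞` (tower = the theorem `anticyclotomicTowerSharp`)
  obtain ⟨C, F, -, hFDt, -, hFβ, hfwd, ⟨g, hg, hrev⟩, z, hz, hcyc⟩ :=
    exists_coherent_pair_envelope_class (W := W) hK hyp.heegner Dt H.dvd_sq_sub jbar hyp.ordinary hpN κ hyp.topGenerator
      (fun k ↦ anticyclotomicTowerSharp K p hp_odd hK κ hyp.anticyclotomic jbar k)
      (card_ringClassGalOver_prime_one_of_frame hK hyp.discr_odd hyp.discr_ne hp hHp jbar) hyp.noPTorsion D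
  have hfwd' : ((p : IwasawaAlgebra p) ^ 0) • heegnerModule D F ≤ stabilizedHeegnerModule D C := by
    rw [pow_zero, one_smul]
    exact hfwd
  -- Thm. 6.5.2: `𝔖` f.g. of `Λ`-rank one and `(p^m') · I(Λκ_∞(C))² ⊆ char(X_tors)`
  obtain ⟨⟨hSfin, hS1⟩, -⟩ := h652 (W.conductorNorm ℤ) W K p κ γ jbar hyp D C X
  haveI : Module.Finite (IwasawaAlgebra p) D.S := hSfin
  obtain ⟨m, hm⟩ := CastellaGrossiSkinner2025.span_pow_mul_sq_le_charIdeal_torsion_of_thm652_stabilized h652 hyp D C X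
  -- F-411 at the class `κ_∞`: `𝔖/Λκ_∞(C)` torsion (with rank one); moved to `𝔖/ℋ_∞(F)`; forward envelope on ideals
  obtain ⟨-, htorC⟩ :=
    HeegnerStabilizedOfKSLeaf.torsionFree_and_isTorsion_quotient_of_kolyvaginSystemLeaf hKS hyp jbar D C hz hcyc hS1
  have htorF : Module.IsTorsion (IwasawaAlgebra p) (D.S ⧸ heegnerModule D F) :=
    isTorsion_quotient_heegnerModule_of_smul_stabilizedHeegnerModule_le D F C hg hrev htorC
  obtain ⟨n, henv⟩ :=
    exists_span_pow_mul_heegnerCharIdeal_le_stabilizedHeegnerCharIdeal_of_pow_smul_le D F C 0 hfwd' htorF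
  refine ⟨D, F, X, m + n * 2, hFDt, hFβ, hSfin, hS1, htorF, ?_⟩
  calc Ideal.span {((p : IwasawaAlgebra p) ^ (m + n * 2))} * heegnerCharIdeal D F ^ 2
      = Ideal.span {((p : IwasawaAlgebra p) ^ m)} *
          (Ideal.span {((p : IwasawaAlgebra p) ^ n)} * heegnerCharIdeal D F) ^ 2 := by
        rw [span_singleton_mul_sq, ← pow_mul, ← pow_add]
    _ ≤ Ideal.span {((p : IwasawaAlgebra p) ^ m)} * stabilizedHeegnerCharIdeal D C ^ 2 :=
        Ideal.mul_mono_right (Ideal.pow_right_mono henv 2)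
    _ ≤ _ := hm

/-- **THE UNTIED HOWARD CONTAINMENT from the Kolyvagin-system leaf (F-411) and CGS 2025 Thm. 6.5.2, class-free and route-free**:
on every frame satisfying `Thm413Hypotheses (W.conductorNorm ℤ) W K p κ γ` with `p` split in `K` and `p ∤ N_E`, for every `jbar`,
`Dt`, `H`: `∃ D F X, I(ℋ_∞(F))² ⊆ char_Λ(X_{Λ-tors})` — ANY class number, torsion depth, Selmer corank. From the localized package
by the μ-blind promotion `PrintX9Rescaling.howardContainment_of_localized_family` (`F := p^m • F₀`; «`E(K_n)[p] = 0`» along the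
tower from (h1) by `fixedGeomPoints_eq_zero_of_smul_eq_zero_of_noPTorsion`; non-torsion element of `ℋ_∞(F₀)` by rank bookkeeping).
NOT route currency (PIN-1 / R0). [cite: CastellaGrossiLeeSkinner2022, Thm. 4.1.1, Rem. 4.1.4, §3.2 (h1)]
[cite: CastellaGrossiSkinner2025, Thm. 6.5.2] [cite: Howard2004HeegnerKolyvagin, §1 ("Fixing a modular parametrization"), Thm. B]
[cite: PerrinRiou1987BSMF, §1 p. 405 (H_∞ depends on the parametrisation π)] -/
theorem howardContainment_untied_of_kolyvaginSystemLeaf_of_thm652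
    (hKS : thm411_exists_kolyvaginSystem_one_ne_zero)
    (h652 : CastellaGrossiSkinner2025.thm652_stabilized_rankOne_charIdeal_torsion_dvd_pLocalized.{0})
    {W : WeierstrassCurve ℚ} [W.IsGloballyMinimal] [NeZero (W.conductorNorm ℤ)] {p : ℕ} [Fact p.Prime]
    {K : Type} [Field K] [NumberField K] {κ : ZpExtension K p} {γ : Field.absoluteGaloisGroup K}
    (hyp : Thm413Hypotheses (W.conductorNorm ℤ) W K p κ γ) (hHp : SatisfiesHeegnerHypothesis p K)
    (hpN : ¬ p ∣ W.conductorNorm ℤ) (jbar : AlgebraicClosure K →+* ℂ)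
    (Dt : ModularParametrizationData W (W.conductorNorm ℤ)) (H : HeegnerDatum (W.conductorNorm ℤ) (NumberField.discr K)) :
    ∃ (D : (W.baseChange K).LambdaAdicSelmerData κ γ) (F : HeegnerFamily (W.conductorNorm ℤ) W K κ jbar)
      (X : (W.baseChange K).SelmerDualData κ γ),
      heegnerCharIdeal D F ^ 2 ≤
        Module.charIdeal (IwasawaAlgebra p) (Submodule.torsion (IwasawaAlgebra p) X.X) := by
  haveI : W.IsElliptic := hyp.isElliptic
  obtain ⟨D, F₀, X, m, -, -, hSfin, hS1, htorF, hm⟩ :=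
    howardContainment_untied_localized_of_kolyvaginSystemLeaf_of_thm652 hKS h652 hyp hHp hpN jbar Dt H
  haveI : Module.Finite (IwasawaAlgebra p) D.S := hSfin
  obtain ⟨F, hF⟩ := PrintX9Rescaling.howardContainment_of_localized_family D X F₀ m hSfin
    (fun n P hP hpP ↦ PrintX9Rescaling.fixedGeomPoints_eq_zero_of_smul_eq_zero_of_noPTorsion (W.baseChange K) κ
      hyp.noPTorsion n hP hpP)
    htorF (PrintX9Rescaling.exists_nonTorsion_mem_of_finrank_eq_one hS1 (heegnerModule D F₀) htorF) hm
  exact ⟨D, F, X, hF⟩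

end Summit.BirchSwinnertonDyer.BirchSwinnertonDyer.Theorems.UntiedHowardContainmentOfKSLeaf

end
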